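import Summits.CriticalPhenomena.PercolationContinuityZ3.Theses.PercNonProliferation
import Summits.CriticalPhenomena.PercolationContinuityZ3.Theorems.NonProliferation.Negative.AboveSix
import Summits.CriticalPhenomena.PercolationContinuityZ3.Theorems.NonProliferation.Negative.MZeroSlice
import Literature.Barriers.CriticalPhenomena.SpanningClustersAboveSix
import Literature.Probability.Percolation.RussoFormula
import Summits.CriticalPhenomena.PercolationContinuityZ3.Theorems.PercNonProliferationNonProliferationStubTypeTable
import Summits.CriticalPhenomena.PercolationContinuityZ3.Theorems.PercNonProliferationNonProliferationStubSignedRusso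
import Summits.CriticalPhenomena.PercolationContinuityZ3.Theorems.PercNonProliferationNonProliferationStubScreening
import Summits.CriticalPhenomena.PercolationContinuityZ3.Theorems.PercNonProliferationNonProliferationStubAnchor
import Summits.CriticalPhenomena.PercolationContinuityZ3.Theorems.PercNonProliferationNonProliferationStubLedger
import Summits.CriticalPhenomena.PercolationContinuityZ3.Theorems.PercNonProliferationNonProliferationStubLogLedger

/-!
# Line `birth-merge-ledger` — checked skeleton for the crux `NonProliferation`
# (stmt-CriticalPhenomena-4444, route `PercNonProliferation`, rank 2) — LEAD'S RESHAPE (gen 2)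

Crux (fixed, by name): `PercNonProliferation.NonProliferation` —
`∃ M c, 0 < c ∧ ∃ᶠ n, c ≤ P_{p_c(ℤ³)}(N_n ≤ M)`, where `N_n` is the number of clusters of the open
graph INDUCED on the free box `B(2n)` meeting both `B(n)` and `∂ⁱⁿB(2n)`, typed through
representatives: `{N_n ≤ M} = (repEvent 3 M n)ᶜ`
(`Theorems.NonProliferation.Negative.nonProliferation_iff`, `Iff.rfl`).

THE LINE (idea card `Cruxes/NonProliferation/Ideas/birth-merge-ledger.md`, planner's line card
`Lines/birth-merge-ledger.md`). Along the monotone coupling `t ↦ ω_t`, `N_n(t)` is a birth–death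
process: opening a lattice edge `e = {x,y}` of `B(2n)` changes `N_n` by `+1` (BIRTH), `-1` (MERGE)
or `0`. Russo's formula for the bounded NON-MONOTONE observable `N_n = Σ_k 1{N_n ≥ k+1}` gives the
LEDGER `E_b N_n - E_a N_n = ∫_a^b births - ∫_a^b merges`; the SCREENING inequality
`(1 - u_n(t)) · P_t(Δ_e N = +1) ≤ P_t(e pivotal for annulusCrossing)` integrates (with the anchors
`E_0 N_n = 0 = u_n(0)`, `n ≥ 1`) to the LOG-LEDGER `E_b N_n + ∫_0^b merges ≤ -log(1 - u_n(b))`;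
hence up to any `s` with `u_n(s) ≤ 1/2` at most `log 2 ≤ 1` births happen in expectation, and the
crux follows by Markov as soon as the births INSIDE THE CRITICAL WINDOW `[s, p_c]` are bounded
along a subsequence (`stub_windowBirths`, OPEN, the only place where `d = 3` enters).

## Reshape by the line lead (2026-08-16): 7 registered stubs, probabilistic cores split from glue

The planner's `stub_logLedger` USED `stub_ledger` (ledger on `[0,b]`), so the two provable stubs were
sequential. The lead re-cut the SAME composition into independent, individually provable pieces
(each a self-contained statement over tree vocabulary; the two "glue" stubs are IMPLICATIONS whose
hypotheses are the neighbouring stubs' statements spelled out, so every stub is provable on its own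
and the skeleton composes them):

* `stub_typeTable` (combinatorial, every `d n e ω`): for a lattice edge `e` of `B(2n)`,
  `Σ_{k<#B(n)} (1[ω ∪ e ∈ repEvent_k] - 1[ω ∖ e ∈ repEvent_k]) = 1[birth_e](ω) - 1[merge_e](ω)`
  (the type table `Δ_e N ∈ {-1,0,+1}` through the layer-cake `N = Σ_k 1{N ≥ k+1}`, `N ≤ #B(n)`).
* `stub_signedRusso` (KNOWN, Grimmett 1999 Thm 2.32 / Margulis–Russo for arbitrary cylinder events,
  on `ℤ^d`): for `A` determined by a finite `K`, `d/dt P_t(A) = Σ_{e∈K} [P_t(e ∈ E, ω ∪ e ∈ A) -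
  P_t(e ∈ E, ω ∖ e ∈ A)]` on `(0,1)` (the pairing `S ↔ S ∪ {e}` of `Russo.sum_dweight_eq_measureReal_pivotal`
  WITHOUT monotonicity).
* `stub_screening` (NEW, probabilistic core of the log-ledger, every `d n`, `t ∈ (0,1)`, lattice edge
  `e` of `B(2n)`): `(1 - u_n(t)) · P_t(birth_e) ≤ P_t(e pivotal for annulusCrossing d n)` (partition
  `birth_e` by the two explored box-clusters `(I, O)` of `x, y` in `ω ∖ e`; disjoint edge supports give
  independence from "no open crossing of `B(2n)` avoiding the edges touching `I ∪ O` and `e`", which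
  contains "no open crossing of `B(2n)`"; on the intersection `e` is pivotal).
* `stub_anchor` (t = 0, `n ≥ 1`): `P_0(repEvent d k n) = 0` for all `k` and `u_n(0) = 0`
  (`setBernoulli_zero`: all edges closed; `B(n) ∩ ∂ⁱⁿB(2n) = ∅`).
* `stub_ledger` (calculus glue): `stub_signedRusso → stub_typeTable → LEDGER`, LEDGER = the planner's
  integrated identity on `[a,b] ⊆ [0,1]` (sum Russo over the layers, swap sums, non-lattice pairs
  vanish, expectation of the type table, FTC with continuity at the endpoints).
* `stub_logLedger` (calculus glue): `LEDGER → stub_screening → stub_anchor → LOG-LEDGER (n ≥ 1)`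
  (Russo for the increasing local event `annulusCrossing` — `russo_formula_sum_holds` —, monotonicity
  `u_n(t) ≤ u_n(b) < 1` on `[0,b]`, `births ≤ u'/(1-u) = (-log(1-u))'`, integrate).
* `stub_windowBirths` (C⁺, OPEN, hardest; `d = 3` only; UNCHANGED from the planner's skeleton):
  `∃ C, ∃ᶠ n, ∃ s ∈ [0, p_c], u_n(s) ≤ 1/2 ∧ ∫_s^{p_c} births ≤ C`.

STATUS (2026-08-16T09:10Z): stubs 1–6 are LANDED THEOREMS of the tree (wave 1 of the lead's workers; all
`--supports stmt-CriticalPhenomena-4444`, kernel-checked, standard axioms):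
`Theorems/PercNonProliferationNonProliferationStubTypeTable.lean` (p90978), `…StubSignedRusso.lean` (p91443),
`…StubScreening.lean` (p93249), `…StubAnchor.lean` (p91795), `…StubLedger.lean` (p92063), `…StubLogLedger.lean`
(p92387); below, `stub_typeTable … stub_logLedger` are one-line aliases of those theorems (no `sorry`). The ONLY
remaining `sorry` is `stub_windowBirths` (OPEN). Consequently `Ledger`, `LogLedger` hold unconditionally
(`ledger_holds`, `logLedger_holds`) and the calibration `windowBirthsDim_false_above_six'` is unconditional.

`NonProliferation_of : Stubs.stub_windowBirths → NonProliferation` (gen 3; hypothesis = the one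
remaining stub `Prop` BY NAME; gen 2's seven-hypothesis form is kept as `NonProliferation_of_stubs`)
is PROVED here (no `sorry`) as the `d = 3` instance of `nonProliferationDim_of_window` (`E_{p_c} N_n ≤ log 2 + C`, then Markov over the antitone
family `repEvent` with `M + 1 = 2⌈max C 0⌉₊ + 4`, `c = 1/2`), and
`NonProliferation_proof : NonProliferation` applies it to the seven sorried stubs.
Barrier calibration kept: `windowBirthsDim_false_above_six` / `_of_hara` (granted the six provable
stubs, `WindowBirthsDim d` is false for `d ≥ 7` under `TwoPointBoundedRatio d`, by the landed
`Negative.nonProliferation_false_of_twoPointBoundedRatio`).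

Disproof / Negative side honoured (`Cruxes/NonProliferation/Disproof.lean` as of 2026-08-16T05:53Z;
landed `Theorems/NonProliferation/Negative/AboveSix.lean`, `MZeroSlice.lean`, both imported):
`nonProliferation_false_without_dimThree` — the dimension is load-bearing; the six provable stubs are
dimension-free and consistent above six; `H = (d = 3)` enters at `stub_windowBirths` only.
`-- Targets` of the Disproof: none yet.
-/

noncomputable section

open MeasureTheory Filter Topology
open Literature.Probability.LatticeModels Literature.Probability.Percolation
open Literature.Barriers.CriticalPhenomena
open Summit.CriticalPhenomena.PercolationContinuityZ3.Theorems.NonProliferation.Negative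

namespace Summit.CriticalPhenomena.PercolationContinuityZ3.Cruxes.NonProliferation.BirthMergeLedger

/-! ## Vocabulary of the ledger (reducible abbreviations; the stubs below are these, spelled out) -/

/-- `P_t` on `ℤ^d`: bond percolation at the clamped real parameter `t`. -/
abbrev P (d : ℕ) (t : ℝ) : Measure (BondConfig (Site d)) :=
  bondPercolation (zdGraph d) (Set.projIcc (0 : ℝ) 1 zero_le_one t)

/-- `u_n(t) = P_t(B(n) ↔ ∂ⁱⁿB(2n) in B(2n))`. -/
abbrev crossProb (d : ℕ) (t : ℝ) (n : ℕ) : ℝ := (P d t).real (annulusCrossing d n)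

/-- `E_t[N_n] = Σ_{k < #B(n)} P_t(N_n ≥ k+1)` (layer-cake; `N_n ≤ #B(n)`). -/
abbrev meanN (d : ℕ) (t : ℝ) (n : ℕ) : ℝ :=
  ∑ k ∈ Finset.range (box d n).card, (P d t).real (repEvent d k n)

/-- `{Δ_e N_n = +1}`: opening `e` creates a new spanning cluster (read on `ω ∖ {e}`). -/
abbrev birthEvent (d n : ℕ) (e : Sym2 (Site d)) : Set (BondConfig (Site d)) :=
  {ω : BondConfig (Site d) | ∃ x y : Site d, e = s(x, y) ∧
    (∃ v ∈ box d n, ω \ {e} ∈ openConnIn (↑(box d (2 * n)) : Set (Site d)) x v) ∧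
    (∀ w ∈ innerBoundary (zdGraph d) (box d (2 * n)),
      ω \ {e} ∉ openConnIn (↑(box d (2 * n)) : Set (Site d)) x w) ∧
    (∃ w ∈ innerBoundary (zdGraph d) (box d (2 * n)),
      ω \ {e} ∈ openConnIn (↑(box d (2 * n)) : Set (Site d)) y w) ∧
    (∀ v ∈ box d n, ω \ {e} ∉ openConnIn (↑(box d (2 * n)) : Set (Site d)) y v)}

/-- `{Δ_e N_n = -1}`: opening `e` merges two distinct spanning clusters (read on `ω ∖ {e}`). -/
abbrev mergeEvent (d n : ℕ) (e : Sym2 (Site d)) : Set (BondConfig (Site d)) :=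
  {ω : BondConfig (Site d) | ∃ x y : Site d, e = s(x, y) ∧
    ω \ {e} ∉ openConnIn (↑(box d (2 * n)) : Set (Site d)) x y ∧
    (∃ v ∈ box d n, ω \ {e} ∈ openConnIn (↑(box d (2 * n)) : Set (Site d)) x v) ∧
    (∃ w ∈ innerBoundary (zdGraph d) (box d (2 * n)),
      ω \ {e} ∈ openConnIn (↑(box d (2 * n)) : Set (Site d)) x w) ∧
    (∃ v ∈ box d n, ω \ {e} ∈ openConnIn (↑(box d (2 * n)) : Set (Site d)) y v) ∧
    (∃ w ∈ innerBoundary (zdGraph d) (box d (2 * n)),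
      ω \ {e} ∈ openConnIn (↑(box d (2 * n)) : Set (Site d)) y w)}

/-- `births(t) = Σ_{e ∈ E(B(2n))} P_t(Δ_e N = +1)`. -/
abbrev birthRate (d : ℕ) (t : ℝ) (n : ℕ) : ℝ :=
  ∑ e ∈ edgesIn (zdGraph d) (box d (2 * n)), (P d t).real (birthEvent d n e)

/-- `merges(t) = Σ_{e ∈ E(B(2n))} P_t(Δ_e N = -1)`. -/
abbrev mergeRate (d : ℕ) (t : ℝ) (n : ℕ) : ℝ :=
  ∑ e ∈ edgesIn (zdGraph d) (box d (2 * n)), (P d t).real (mergeEvent d n e)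

/-- The integrated LEDGER on `[a,b] ⊆ [0,1]` (conclusion of `stub_ledger`):
`E_b[N_n] - E_a[N_n] = ∫_a^b births - ∫_a^b merges`. -/
abbrev Ledger : Prop :=
  ∀ (d n : ℕ) (a b : ℝ), 0 ≤ a → a ≤ b → b ≤ 1 →
    meanN d b n - meanN d a n = (∫ t in a..b, birthRate d t n) - ∫ t in a..b, mergeRate d t n

/-- The LOG-LEDGER for `n ≥ 1` (conclusion of `stub_logLedger`):
`E_b[N_n] + ∫_0^b merges ≤ -log(1 - u_n(b))` whenever `u_n(b) < 1`. -/
abbrev LogLedger : Prop :=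
  ∀ (d n : ℕ) (b : ℝ), 1 ≤ n → 0 ≤ b → b ≤ 1 → crossProb d b n < 1 →
    meanN d b n + (∫ t in (0 : ℝ)..b, mergeRate d t n) ≤ - Real.log (1 - crossProb d b n)

/-! ## The seven registered stubs: precise `Prop`s `Stubs.stub_*` + sorried theorems `stub_*`

D-0027 §3.3 shape: `NonProliferation_of : Stubs.stub_windowBirths → NonProliferation` (hypothesis =
the one still-open declared stub `Prop`, BY NAME; stubs 1–6 below are aliases of landed theorems), the registered stubs
`stub_* : <Stubs.stub_* spelled out over tree declarations> := by sorry` (vocabulary: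
`bondPercolation`, `zdGraph`, `box`, `innerBoundary`, `edgesIn`, `openConnIn`, `annulusCrossing`,
`criticalProbI`, `DeterminedBy`, `IsPivotal`, and the landed `Negative.repEvent`), and
`NonProliferation_proof`. Notation in comments: `P_t := bondPercolation (zdGraph d) (projIcc 0 1 t)`,
`B := B(2n)`, `∂ := ∂ⁱⁿB(2n)`, `ω' := ω ∖ {e}`. -/

namespace Stubs

/-- **Stub `Prop` 1 (`typeTable`)** — the type table of `Δ_e N`, layer by layer. -/
def stub_typeTable : Prop :=
  ∀ (d n : ℕ) (e : Sym2 (Site d)) (ω : BondConfig (Site d)), e ∈ edgesIn (zdGraph d) (box d (2 * n)) →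
    (∑ k ∈ Finset.range (box d n).card,
        ((repEvent d k n).indicator (fun _ => (1 : ℝ)) (insert e ω) -
          (repEvent d k n).indicator (fun _ => (1 : ℝ)) (ω \ {e}))) =
      (birthEvent d n e).indicator (fun _ => (1 : ℝ)) ω - (mergeEvent d n e).indicator (fun _ => (1 : ℝ)) ω

/-- **Stub `Prop` 2 (`signedRusso`)** — Margulis–Russo for an arbitrary cylinder event on `ℤ^d`. -/
def stub_signedRusso : Prop :=
  ∀ (d : ℕ) (A : Set (BondConfig (Site d))) (K : Finset (Sym2 (Site d))),
    DeterminedBy A (↑K : Set (Sym2 (Site d))) → ∀ t ∈ Set.Ioo (0 : ℝ) 1,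
      HasDerivAt (fun s : ℝ => (P d s).real A)
        (∑ e ∈ K, ((P d t).real {ω | e ∈ (zdGraph d).edgeSet ∧ insert e ω ∈ A} -
          (P d t).real {ω | e ∈ (zdGraph d).edgeSet ∧ ω \ {e} ∈ A})) t

/-- **Stub `Prop` 3 (`screening`)** — pointwise screening at a lattice edge of `B(2n)`. -/
def stub_screening : Prop :=
  ∀ (d n : ℕ) (t : ℝ), t ∈ Set.Ioo (0 : ℝ) 1 → ∀ e ∈ edgesIn (zdGraph d) (box d (2 * n)),
    (1 - crossProb d t n) * (P d t).real (birthEvent d n e) ≤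
      (P d t).real {ω | IsPivotal (annulusCrossing d n) e ω}

/-- **Stub `Prop` 4 (`anchor`)** — the trivial anchor `t = 0` (`n ≥ 1`). -/
def stub_anchor : Prop :=
  ∀ (d n : ℕ), 1 ≤ n → (∀ k : ℕ, (P d 0).real (repEvent d k n) = 0) ∧ crossProb d 0 n = 0

/-- **Stub `Prop` 5 (`ledger`, glue)** — signed Russo + type table ⟹ the integrated LEDGER. -/
def stub_ledger : Prop := stub_signedRusso → stub_typeTable → Ledger

/-- **Stub `Prop` 6 (`logLedger`, glue)** — LEDGER + screening + anchor ⟹ the LOG-LEDGER (`n ≥ 1`). -/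
def stub_logLedger : Prop := Ledger → stub_screening → stub_anchor → LogLedger

/-- **Stub `Prop` 7 (`windowBirths`, the transfer target C⁺; OPEN, hardest; `d = 3`)** —
boundedly many births after the crossing onset: `∃ C, ∃ᶠ n, ∃ s ∈ [0, p_c(ℤ³)]` with
`u_n(s) ≤ 1/2` and `∫_s^{p_c} births ≤ C`. -/
def stub_windowBirths : Prop :=
  ∃ C : ℝ, ∃ᶠ n : ℕ in atTop, ∃ s : ℝ, 0 ≤ s ∧ s ≤ (criticalProbI 3 : ℝ) ∧
    crossProb 3 s n ≤ 1 / 2 ∧ ∫ t in s..(criticalProbI 3 : ℝ), birthRate 3 t n ≤ C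

end Stubs

/-- **stub 1 (registered) = `Stubs.stub_typeTable` spelled out — the TYPE TABLE of `Δ_e N`.**
For every `d`, `n`, every lattice edge `e` of `B(2n)` and every configuration `ω`:
`Σ_{k<#B(n)} (1[ω ∪ {e} ∈ repEvent d k n] - 1[ω ∖ {e} ∈ repEvent d k n]) = 1[birth_e](ω) - 1[merge_e](ω)`.
Proof route (pure combinatorics, no measure): let `N(η)` be the number of connected components of the
open graph of `η` induced on `B(2n)` (adjacency `s(u,v) ∈ η`, `u ≠ v`, `u v ∈ B(2n)`; NO restriction to
lattice pairs is needed) that meet both `B(n)` and `∂ⁱⁿB(2n)`; then `η ∈ repEvent d k n ↔ k+1 ≤ N(η)`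
(representatives ↦ their distinct components; components ↦ one point of `B(n)` each, joined inside
`B(2n)` to a point of `∂` of the component, pairwise unjoined) and `N(η) ≤ #B(n)`, so the left side is
`N(ω ∪ e) - N(ω ∖ e)`. With `ω' = ω ∖ e`, `e = s(x,y)`, `x ≠ y` (a lattice edge): if `x ↔ y` in `ω'`
(inside `B(2n)`) nothing changes; otherwise the components of `ω ∪ e` are those of `ω'` with `C(x)`,
`C(y)` merged, whence `Δ = 1[C(x) ∪ C(y) spans] - 1[C(x) spans] - 1[C(y) spans] ∈ {-1,0,+1}`, `= +1`
iff birth (one piece meets `B(n)` not `∂`, the other `∂` not `B(n)`; the two orientations are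
exclusive), `= -1` iff merge (both span, `x ↮ y`). Degenerate indices: `n = 0` gives `#B(0) = 1`,
consistent. -/
theorem stub_typeTable :
    ∀ (d n : ℕ) (e : Sym2 (Site d)) (ω : BondConfig (Site d)), e ∈ edgesIn (zdGraph d) (box d (2 * n)) →
      (∑ k ∈ Finset.range (box d n).card,
          ((repEvent d k n).indicator (fun _ => (1 : ℝ)) (insert e ω) -
            (repEvent d k n).indicator (fun _ => (1 : ℝ)) (ω \ {e}))) =
        {ω' : BondConfig (Site d) | ∃ x y : Site d, e = s(x, y) ∧
            (∃ v ∈ box d n, ω' \ {e} ∈ openConnIn (↑(box d (2 * n)) : Set (Site d)) x v) ∧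
            (∀ w ∈ innerBoundary (zdGraph d) (box d (2 * n)),
              ω' \ {e} ∉ openConnIn (↑(box d (2 * n)) : Set (Site d)) x w) ∧
            (∃ w ∈ innerBoundary (zdGraph d) (box d (2 * n)),
              ω' \ {e} ∈ openConnIn (↑(box d (2 * n)) : Set (Site d)) y w) ∧
            (∀ v ∈ box d n, ω' \ {e} ∉ openConnIn (↑(box d (2 * n)) : Set (Site d)) y v)}.indicator
            (fun _ => (1 : ℝ)) ω -
          {ω' : BondConfig (Site d) | ∃ x y : Site d, e = s(x, y) ∧
            ω' \ {e} ∉ openConnIn (↑(box d (2 * n)) : Set (Site d)) x y ∧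
            (∃ v ∈ box d n, ω' \ {e} ∈ openConnIn (↑(box d (2 * n)) : Set (Site d)) x v) ∧
            (∃ w ∈ innerBoundary (zdGraph d) (box d (2 * n)),
              ω' \ {e} ∈ openConnIn (↑(box d (2 * n)) : Set (Site d)) x w) ∧
            (∃ v ∈ box d n, ω' \ {e} ∈ openConnIn (↑(box d (2 * n)) : Set (Site d)) y v) ∧
            (∃ w ∈ innerBoundary (zdGraph d) (box d (2 * n)),
              ω' \ {e} ∈ openConnIn (↑(box d (2 * n)) : Set (Site d)) y w)}.indicator
            (fun _ => (1 : ℝ)) ω :=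
  Summit.CriticalPhenomena.PercolationContinuityZ3.Theorems.NonProliferation.stub_typeTable

/-- **stub 2 (registered) = `Stubs.stub_signedRusso` spelled out — the Margulis–Russo formula for an
ARBITRARY cylinder event** (Grimmett 1999, Thm. (2.32), p. 46: `d/dp E_p X = Σ_e E_p(δ_e X)` for `X`
depending on finitely many edges; here `X = 1_A`). For `A` determined by the finite set of pairs `K`,
on `(0,1)`: `d/dt P_t(A) = Σ_{e ∈ K} [P_t(e ∈ E(ℤ^d) ∧ ω ∪ {e} ∈ A) - P_t(e ∈ E(ℤ^d) ∧ ω ∖ {e} ∈ A)]`.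
Proof route: exactly `russo_formula_sum_holds` (`RussoFormula.lean`) with the pairing lemma
`Russo.sum_dweight_eq_measureReal_pivotal` replaced by its unsigned-free form: for `e ∈ K`,
`Σ_{S ⊆ K} 1[S ∈ A] (∏_{j ≠ e} weight) dweight_e = Σ_{S ⊆ K∖e} (∏_{j≠e} weight)(1[S ∪ e ∈ A] - 1[S ∈ A])
= P(e ∈ E ∧ insert e ω ∈ A) - P(e ∈ E ∧ ω ∖ e ∈ A)` (both events determined by `K.erase e`;
`Russo.measureReal_eq_cylPoly`; pairs outside `E(ℤ^d)` have `dweight = 0` and contribute `0` on both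
sides). A graph-general version belongs in `Literature/Probability/Percolation/` next to
`RussoFormula.lean`; this stub is its `zdGraph d` instance. -/
theorem stub_signedRusso :
    ∀ (d : ℕ) (A : Set (BondConfig (Site d))) (K : Finset (Sym2 (Site d))),
      DeterminedBy A (↑K : Set (Sym2 (Site d))) → ∀ t ∈ Set.Ioo (0 : ℝ) 1,
        HasDerivAt
          (fun s : ℝ => (bondPercolation (zdGraph d) (Set.projIcc (0 : ℝ) 1 zero_le_one s)).real A)
          (∑ e ∈ K,
            ((bondPercolation (zdGraph d) (Set.projIcc (0 : ℝ) 1 zero_le_one t)).real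
                {ω | e ∈ (zdGraph d).edgeSet ∧ insert e ω ∈ A} -
              (bondPercolation (zdGraph d) (Set.projIcc (0 : ℝ) 1 zero_le_one t)).real
                {ω | e ∈ (zdGraph d).edgeSet ∧ ω \ {e} ∈ A})) t :=
  Summit.CriticalPhenomena.PercolationContinuityZ3.Theorems.NonProliferation.stub_signedRusso

/-- **stub 3 (registered) = `Stubs.stub_screening` spelled out — pointwise SCREENING (NEW; the
probabilistic core of the log-ledger).** For every `d`, `n`, `t ∈ (0,1)` and lattice edge `e` of
`B(2n)`: `(1 - u_n(t)) · P_t(birth_e) ≤ P_t(e pivotal for annulusCrossing d n)`.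
Proof route: write `e = s(x,y)`; partition `birth_e` according to the pair `(I, O)` of box-clusters
of `x` and `y` in `ω ∖ e` (`I ∋ x` meets `B(n)` not `∂`, `O ∋ y` meets `∂` not `B(n)`; finitely many
values, subsets of `B(2n)`); the event `{C^{B}_{ω∖e}(x) = I ∧ C^{B}_{ω∖e}(y) = O}` is determined by the
pairs of `B(2n)` touching `I ∪ O` other than `e` (template: `determinedBy_clusterIs`,
`mem_clusterIs_iff` in `ClusterBoundary.lean`, here inside the finite box and for two clusters), while
`F_{I,O} :=` "no open path of `B(2n)` from `B(n)` to `∂` using only pairs of `B(2n)` NOT touching `I ∪ O`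
and `≠ e`" is determined by the complementary pairs; disjoint supports ⟹
`P(piece ∩ F) = P(piece) · P(F)` (`bondPercolation_real_inter_of_disjoint`, `FiniteEnergy.lean`), and
`P(F_{I,O}) ≥ P((annulusCrossing d n)ᶜ) = 1 - u_n(t)` (`openConnIn` is monotone in `ω`). On
`piece ∩ F_{I,O}`: `ω ∖ e ∉ annulusCrossing` (an open crossing of `ω ∖ e` avoiding the closed boundary
of `I ∪ O` would lie in `F`'s pairs) and `ω ∪ e ∈ annulusCrossing` (`v ↔ x` in `I`, the edge `e`,
`y ↔ w` in `O`; `x ≠ y` as `e ∈ E(ℤ^d)`), i.e. `e` is pivotal. Sum over `(I, O)`. -/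
theorem stub_screening :
    ∀ (d n : ℕ) (t : ℝ), t ∈ Set.Ioo (0 : ℝ) 1 → ∀ e ∈ edgesIn (zdGraph d) (box d (2 * n)),
      (1 - (bondPercolation (zdGraph d) (Set.projIcc (0 : ℝ) 1 zero_le_one t)).real (annulusCrossing d n)) *
          (bondPercolation (zdGraph d) (Set.projIcc (0 : ℝ) 1 zero_le_one t)).real
            {ω : BondConfig (Site d) | ∃ x y : Site d, e = s(x, y) ∧
              (∃ v ∈ box d n, ω \ {e} ∈ openConnIn (↑(box d (2 * n)) : Set (Site d)) x v) ∧
              (∀ w ∈ innerBoundary (zdGraph d) (box d (2 * n)),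
                ω \ {e} ∉ openConnIn (↑(box d (2 * n)) : Set (Site d)) x w) ∧
              (∃ w ∈ innerBoundary (zdGraph d) (box d (2 * n)),
                ω \ {e} ∈ openConnIn (↑(box d (2 * n)) : Set (Site d)) y w) ∧
              (∀ v ∈ box d n, ω \ {e} ∉ openConnIn (↑(box d (2 * n)) : Set (Site d)) y v)} ≤
        (bondPercolation (zdGraph d) (Set.projIcc (0 : ℝ) 1 zero_le_one t)).real
          {ω | IsPivotal (annulusCrossing d n) e ω} :=
  Summit.CriticalPhenomena.PercolationContinuityZ3.Theorems.NonProliferation.stub_screening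

/-- **stub 4 (registered) = `Stubs.stub_anchor` spelled out — the anchor `t = 0`, `n ≥ 1`.**
`P_0(repEvent d k n) = 0` for every `k`, and `u_n(0) = P_0(annulusCrossing d n) = 0`.
Proof route: `Set.projIcc 0 1 _ 0 = 0` (`Set.projIcc_left`), `bondPercolation G 0 = setBer(E,0) =
Measure.dirac ∅` (`setBernoulli_zero`, cf. `theta_bot` in `Percolation.lean`); in the empty
configuration `openConnIn S x y ↔ x = y ∈ S`, and a representative / crossing needs a point of
`B(n) ∩ ∂ⁱⁿB(2n)`, which is empty for `n ≥ 1` (a point of `∂ⁱⁿB(2n)` has a coordinate `= ±2n`;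
for `d = 0` the boundary is empty outright). -/
theorem stub_anchor :
    ∀ (d n : ℕ), 1 ≤ n →
      (∀ k : ℕ, (bondPercolation (zdGraph d) (Set.projIcc (0 : ℝ) 1 zero_le_one 0)).real (repEvent d k n) = 0) ∧
        (bondPercolation (zdGraph d) (Set.projIcc (0 : ℝ) 1 zero_le_one 0)).real (annulusCrossing d n) = 0 :=
  Summit.CriticalPhenomena.PercolationContinuityZ3.Theorems.NonProliferation.stub_anchor

/-- **stub 5 (registered) = `Stubs.stub_ledger` spelled out — the birth/merge LEDGER from the signed
Russo formula and the type table (calculus glue; KNOWN-TYPE).** Hypothesis 1 = `stub_signedRusso`,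
hypothesis 2 = `stub_typeTable` (both verbatim); conclusion: for every `d`, `n`, `0 ≤ a ≤ b ≤ 1`,
`Σ_{k<#B(n)} P_b(repEvent d k n) - Σ_{k<#B(n)} P_a(repEvent d k n) = ∫_a^b births - ∫_a^b merges`.
Proof route: on `(0,1)`, `d/dt Σ_k P_t(repEvent_k) = Σ_k Σ_{e ∈ K} [P_t(e ∈ E ∧ ins) - P_t(e ∈ E ∧ del)]`
with `K = (box d (2n)).sym2` (`DeterminedBy (repEvent d k n) ↑K` from
`PlanarDuality.determinedBy_openConnIn`, as in `Negative.measurableSet_repEvent`); swap the sums; pairs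
`e ∉ E(ℤ^d)` contribute `0`, and `K ∩ E(ℤ^d) = edgesIn (zdGraph d) (box d (2n))` (`mem_edgesIn_iff`,
`Finset.mem_sym2_iff`); for a lattice edge, `Σ_k [P(ins⁻¹ A_k) - P(del⁻¹ A_k)] = E[Σ_k (1_{A_k}∘ins -
1_{A_k}∘del)] = E[1_birth - 1_merge] = P(birth_e) - P(merge_e)` by hypothesis 2 (measurability: the
maps `insert e`, `· \ {e}` are measurable, cf. `measurableSet_setOf_isPivotal` in `IntegratedRusso.lean`;
birth/merge events are determined by `K`); then the FTC `intervalIntegral.integral_eq_sub_of_hasDerivAt_of_le`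
on `[a,b]` with continuity on `[0,1]` of `t ↦ P_t(local event)`
(`continuous_bondPercolation_real_of_determinedBy ∘ continuous_projIcc`, template
`integral_sum_pivProb_boxConn_le`). -/
theorem stub_ledger :
    (∀ (d : ℕ) (A : Set (BondConfig (Site d))) (K : Finset (Sym2 (Site d))),
      DeterminedBy A (↑K : Set (Sym2 (Site d))) → ∀ t ∈ Set.Ioo (0 : ℝ) 1,
        HasDerivAt
          (fun s : ℝ => (bondPercolation (zdGraph d) (Set.projIcc (0 : ℝ) 1 zero_le_one s)).real A)
          (∑ e ∈ K,
            ((bondPercolation (zdGraph d) (Set.projIcc (0 : ℝ) 1 zero_le_one t)).real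
                {ω | e ∈ (zdGraph d).edgeSet ∧ insert e ω ∈ A} -
              (bondPercolation (zdGraph d) (Set.projIcc (0 : ℝ) 1 zero_le_one t)).real
                {ω | e ∈ (zdGraph d).edgeSet ∧ ω \ {e} ∈ A})) t) →
    (∀ (d n : ℕ) (e : Sym2 (Site d)) (ω : BondConfig (Site d)), e ∈ edgesIn (zdGraph d) (box d (2 * n)) →
      (∑ k ∈ Finset.range (box d n).card,
          ((repEvent d k n).indicator (fun _ => (1 : ℝ)) (insert e ω) -
            (repEvent d k n).indicator (fun _ => (1 : ℝ)) (ω \ {e}))) =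
        {ω' : BondConfig (Site d) | ∃ x y : Site d, e = s(x, y) ∧
            (∃ v ∈ box d n, ω' \ {e} ∈ openConnIn (↑(box d (2 * n)) : Set (Site d)) x v) ∧
            (∀ w ∈ innerBoundary (zdGraph d) (box d (2 * n)),
              ω' \ {e} ∉ openConnIn (↑(box d (2 * n)) : Set (Site d)) x w) ∧
            (∃ w ∈ innerBoundary (zdGraph d) (box d (2 * n)),
              ω' \ {e} ∈ openConnIn (↑(box d (2 * n)) : Set (Site d)) y w) ∧
            (∀ v ∈ box d n, ω' \ {e} ∉ openConnIn (↑(box d (2 * n)) : Set (Site d)) y v)}.indicator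
            (fun _ => (1 : ℝ)) ω -
          {ω' : BondConfig (Site d) | ∃ x y : Site d, e = s(x, y) ∧
            ω' \ {e} ∉ openConnIn (↑(box d (2 * n)) : Set (Site d)) x y ∧
            (∃ v ∈ box d n, ω' \ {e} ∈ openConnIn (↑(box d (2 * n)) : Set (Site d)) x v) ∧
            (∃ w ∈ innerBoundary (zdGraph d) (box d (2 * n)),
              ω' \ {e} ∈ openConnIn (↑(box d (2 * n)) : Set (Site d)) x w) ∧
            (∃ v ∈ box d n, ω' \ {e} ∈ openConnIn (↑(box d (2 * n)) : Set (Site d)) y v) ∧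
            (∃ w ∈ innerBoundary (zdGraph d) (box d (2 * n)),
              ω' \ {e} ∈ openConnIn (↑(box d (2 * n)) : Set (Site d)) y w)}.indicator
            (fun _ => (1 : ℝ)) ω) →
    ∀ (d n : ℕ) (a b : ℝ), 0 ≤ a → a ≤ b → b ≤ 1 →
      (∑ k ∈ Finset.range (box d n).card,
          (bondPercolation (zdGraph d) (Set.projIcc (0 : ℝ) 1 zero_le_one b)).real (repEvent d k n)) -
        (∑ k ∈ Finset.range (box d n).card,
            (bondPercolation (zdGraph d) (Set.projIcc (0 : ℝ) 1 zero_le_one a)).real (repEvent d k n)) =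
      (∫ t in a..b, ∑ e ∈ edgesIn (zdGraph d) (box d (2 * n)),
          (bondPercolation (zdGraph d) (Set.projIcc (0 : ℝ) 1 zero_le_one t)).real
            {ω : BondConfig (Site d) | ∃ x y : Site d, e = s(x, y) ∧
              (∃ v ∈ box d n, ω \ {e} ∈ openConnIn (↑(box d (2 * n)) : Set (Site d)) x v) ∧
              (∀ w ∈ innerBoundary (zdGraph d) (box d (2 * n)),
                ω \ {e} ∉ openConnIn (↑(box d (2 * n)) : Set (Site d)) x w) ∧
              (∃ w ∈ innerBoundary (zdGraph d) (box d (2 * n)),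
                ω \ {e} ∈ openConnIn (↑(box d (2 * n)) : Set (Site d)) y w) ∧
              (∀ v ∈ box d n, ω \ {e} ∉ openConnIn (↑(box d (2 * n)) : Set (Site d)) y v)}) -
      ∫ t in a..b, ∑ e ∈ edgesIn (zdGraph d) (box d (2 * n)),
          (bondPercolation (zdGraph d) (Set.projIcc (0 : ℝ) 1 zero_le_one t)).real
            {ω : BondConfig (Site d) | ∃ x y : Site d, e = s(x, y) ∧
              ω \ {e} ∉ openConnIn (↑(box d (2 * n)) : Set (Site d)) x y ∧
              (∃ v ∈ box d n, ω \ {e} ∈ openConnIn (↑(box d (2 * n)) : Set (Site d)) x v) ∧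
              (∃ w ∈ innerBoundary (zdGraph d) (box d (2 * n)),
                ω \ {e} ∈ openConnIn (↑(box d (2 * n)) : Set (Site d)) x w) ∧
              (∃ v ∈ box d n, ω \ {e} ∈ openConnIn (↑(box d (2 * n)) : Set (Site d)) y v) ∧
              (∃ w ∈ innerBoundary (zdGraph d) (box d (2 * n)),
                ω \ {e} ∈ openConnIn (↑(box d (2 * n)) : Set (Site d)) y w)} :=
  Summit.CriticalPhenomena.PercolationContinuityZ3.Theorems.NonProliferation.stub_ledger

/-- **stub 6 (registered) = `Stubs.stub_logLedger` spelled out — the LOG-LEDGER from the ledger, the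
pointwise screening and the anchor (calculus glue; `n ≥ 1`).** Hypothesis 1 = the integrated LEDGER
(conclusion of `stub_ledger`), hypothesis 2 = `stub_screening`, hypothesis 3 = `stub_anchor` (all
verbatim); conclusion: for `d`, `n ≥ 1`, `b ∈ [0,1]` with `u_n(b) := P_b(annulusCrossing d n) < 1`,
`Σ_{k<#B(n)} P_b(repEvent d k n) + ∫_0^b merges ≤ -log(1 - u_n(b))`.
Proof route: `u := t ↦ P_t(annulusCrossing d n)` is continuous on `ℝ` (local event:
`continuous_bondPercolation_real_of_determinedBy`; `annulusCrossing` is determined by `(box d (2n)).sym2`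
via `PlanarDuality.determinedBy_openConnIn`), non-decreasing (`real_mono_of_isUpperSet`,
`isUpperSet_openConnIn`; so `u ≤ u(b) < 1` on `[0,b]`), and differentiable on `(0,1)` with
`u' = Σ_{e ∈ K} P_t(e ∈ E ∧ e pivotal) = Σ_{e ∈ edgesIn} P_t(e pivotal)` (`russo_formula_sum_holds`;
pairs outside `E(ℤ^d)` drop; `K ∩ E = edgesIn`, `mem_edgesIn_iff`). By hypothesis 2 (sum over `e`),
`births(t) ≤ u'(t) / (1 - u(t)) = (-log(1 - u))'(t)` on `(0, b)`; `births` is continuous; so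
`∫_0^b births ≤ -log(1 - u(b)) + log(1 - u(0))` (FTC `integral_eq_sub_of_hasDerivAt_of_le` +
`intervalIntegral.integral_mono_on_of_le_Ioo`). Hypothesis 1 with `a = 0`: `E_b N + ∫_0^b merges =
E_0 N + ∫_0^b births`; hypothesis 3: `E_0 N = 0`, `u(0) = 0`. -/
theorem stub_logLedger :
    (∀ (d n : ℕ) (a b : ℝ), 0 ≤ a → a ≤ b → b ≤ 1 →
      (∑ k ∈ Finset.range (box d n).card,
          (bondPercolation (zdGraph d) (Set.projIcc (0 : ℝ) 1 zero_le_one b)).real (repEvent d k n)) -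
        (∑ k ∈ Finset.range (box d n).card,
            (bondPercolation (zdGraph d) (Set.projIcc (0 : ℝ) 1 zero_le_one a)).real (repEvent d k n)) =
      (∫ t in a..b, ∑ e ∈ edgesIn (zdGraph d) (box d (2 * n)),
          (bondPercolation (zdGraph d) (Set.projIcc (0 : ℝ) 1 zero_le_one t)).real
            {ω : BondConfig (Site d) | ∃ x y : Site d, e = s(x, y) ∧
              (∃ v ∈ box d n, ω \ {e} ∈ openConnIn (↑(box d (2 * n)) : Set (Site d)) x v) ∧
              (∀ w ∈ innerBoundary (zdGraph d) (box d (2 * n)),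
                ω \ {e} ∉ openConnIn (↑(box d (2 * n)) : Set (Site d)) x w) ∧
              (∃ w ∈ innerBoundary (zdGraph d) (box d (2 * n)),
                ω \ {e} ∈ openConnIn (↑(box d (2 * n)) : Set (Site d)) y w) ∧
              (∀ v ∈ box d n, ω \ {e} ∉ openConnIn (↑(box d (2 * n)) : Set (Site d)) y v)}) -
      ∫ t in a..b, ∑ e ∈ edgesIn (zdGraph d) (box d (2 * n)),
          (bondPercolation (zdGraph d) (Set.projIcc (0 : ℝ) 1 zero_le_one t)).real
            {ω : BondConfig (Site d) | ∃ x y : Site d, e = s(x, y) ∧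
              ω \ {e} ∉ openConnIn (↑(box d (2 * n)) : Set (Site d)) x y ∧
              (∃ v ∈ box d n, ω \ {e} ∈ openConnIn (↑(box d (2 * n)) : Set (Site d)) x v) ∧
              (∃ w ∈ innerBoundary (zdGraph d) (box d (2 * n)),
                ω \ {e} ∈ openConnIn (↑(box d (2 * n)) : Set (Site d)) x w) ∧
              (∃ v ∈ box d n, ω \ {e} ∈ openConnIn (↑(box d (2 * n)) : Set (Site d)) y v) ∧
              (∃ w ∈ innerBoundary (zdGraph d) (box d (2 * n)),
                ω \ {e} ∈ openConnIn (↑(box d (2 * n)) : Set (Site d)) y w)}) →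
    (∀ (d n : ℕ) (t : ℝ), t ∈ Set.Ioo (0 : ℝ) 1 → ∀ e ∈ edgesIn (zdGraph d) (box d (2 * n)),
      (1 - (bondPercolation (zdGraph d) (Set.projIcc (0 : ℝ) 1 zero_le_one t)).real (annulusCrossing d n)) *
          (bondPercolation (zdGraph d) (Set.projIcc (0 : ℝ) 1 zero_le_one t)).real
            {ω : BondConfig (Site d) | ∃ x y : Site d, e = s(x, y) ∧
              (∃ v ∈ box d n, ω \ {e} ∈ openConnIn (↑(box d (2 * n)) : Set (Site d)) x v) ∧
              (∀ w ∈ innerBoundary (zdGraph d) (box d (2 * n)),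
                ω \ {e} ∉ openConnIn (↑(box d (2 * n)) : Set (Site d)) x w) ∧
              (∃ w ∈ innerBoundary (zdGraph d) (box d (2 * n)),
                ω \ {e} ∈ openConnIn (↑(box d (2 * n)) : Set (Site d)) y w) ∧
              (∀ v ∈ box d n, ω \ {e} ∉ openConnIn (↑(box d (2 * n)) : Set (Site d)) y v)} ≤
        (bondPercolation (zdGraph d) (Set.projIcc (0 : ℝ) 1 zero_le_one t)).real
          {ω | IsPivotal (annulusCrossing d n) e ω}) →
    (∀ (d n : ℕ), 1 ≤ n →
      (∀ k : ℕ, (bondPercolation (zdGraph d) (Set.projIcc (0 : ℝ) 1 zero_le_one 0)).real (repEvent d k n) = 0) ∧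
        (bondPercolation (zdGraph d) (Set.projIcc (0 : ℝ) 1 zero_le_one 0)).real (annulusCrossing d n) = 0) →
    ∀ (d n : ℕ) (b : ℝ), 1 ≤ n → 0 ≤ b → b ≤ 1 →
      (bondPercolation (zdGraph d) (Set.projIcc (0 : ℝ) 1 zero_le_one b)).real (annulusCrossing d n) < 1 →
      (∑ k ∈ Finset.range (box d n).card,
          (bondPercolation (zdGraph d) (Set.projIcc (0 : ℝ) 1 zero_le_one b)).real (repEvent d k n)) +
        (∫ t in (0 : ℝ)..b, ∑ e ∈ edgesIn (zdGraph d) (box d (2 * n)),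
          (bondPercolation (zdGraph d) (Set.projIcc (0 : ℝ) 1 zero_le_one t)).real
            {ω : BondConfig (Site d) | ∃ x y : Site d, e = s(x, y) ∧
              ω \ {e} ∉ openConnIn (↑(box d (2 * n)) : Set (Site d)) x y ∧
              (∃ v ∈ box d n, ω \ {e} ∈ openConnIn (↑(box d (2 * n)) : Set (Site d)) x v) ∧
              (∃ w ∈ innerBoundary (zdGraph d) (box d (2 * n)),
                ω \ {e} ∈ openConnIn (↑(box d (2 * n)) : Set (Site d)) x w) ∧
              (∃ v ∈ box d n, ω \ {e} ∈ openConnIn (↑(box d (2 * n)) : Set (Site d)) y v) ∧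
              (∃ w ∈ innerBoundary (zdGraph d) (box d (2 * n)),
                ω \ {e} ∈ openConnIn (↑(box d (2 * n)) : Set (Site d)) y w)}) ≤
      - Real.log (1 - (bondPercolation (zdGraph d) (Set.projIcc (0 : ℝ) 1 zero_le_one b)).real (annulusCrossing d n)) :=
  Summit.CriticalPhenomena.PercolationContinuityZ3.Theorems.NonProliferation.stub_logLedger

/-- **stub 7 (registered) = `Stubs.stub_windowBirths` spelled out — births inside the critical window
(the transfer target C⁺; OPEN, the hardest stub; the only place where `d = 3 < 6` enters; UNCHANGED
from the planner's skeleton).** `∃ C, ∃ᶠ n, ∃ s ∈ [0, p_c(ℤ³)]`, `u_n(s) ≤ 1/2` and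
`∫_s^{p_c} births(t) dt ≤ C`. Logical status: given stubs 1–6 it is EQUIVALENT to the card's
`BirthBudget` and STRONGER than the crux by the window merge count (not a restatement). Why it might
fail: births and merges could both creep up like `log n` with bounded difference (MC j008739: births
18.0 → 19.9, merges 5.2 → 6.8 from `n = 8` to `32`, `E N = 13.3 ± 0.3`); in `d ≥ 7` it is false
(`windowBirthsDim_false_above_six`). Engines named by the card / triage: AKN–Cerf two-arm bounds for
birth sites, sharpness below `p_c`, vdBHK two-cluster conditional association, and the exponent-free
charging of births to unit Russo budgets of increasing events (every birth edge is pivotal for the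
max-flow level event `{F_n ≥ F_n(ω∖e) + 1}`, so `∫_0^{p_c} births ≤ E_{p_c} F_n`). -/
theorem stub_windowBirths :
    ∃ C : ℝ, ∃ᶠ n : ℕ in atTop, ∃ s : ℝ, 0 ≤ s ∧ s ≤ (criticalProbI 3 : ℝ) ∧
      (bondPercolation (zdGraph 3) (Set.projIcc (0 : ℝ) 1 zero_le_one s)).real (annulusCrossing 3 n)
          ≤ 1 / 2 ∧
      ∫ t in s..(criticalProbI 3 : ℝ), ∑ e ∈ edgesIn (zdGraph 3) (box 3 (2 * n)),
          (bondPercolation (zdGraph 3) (Set.projIcc (0 : ℝ) 1 zero_le_one t)).real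
            {ω : BondConfig (Site 3) | ∃ x y : Site 3, e = s(x, y) ∧
              (∃ v ∈ box 3 n, ω \ {e} ∈ openConnIn (↑(box 3 (2 * n)) : Set (Site 3)) x v) ∧
              (∀ w ∈ innerBoundary (zdGraph 3) (box 3 (2 * n)),
                ω \ {e} ∉ openConnIn (↑(box 3 (2 * n)) : Set (Site 3)) x w) ∧
              (∃ w ∈ innerBoundary (zdGraph 3) (box 3 (2 * n)),
                ω \ {e} ∈ openConnIn (↑(box 3 (2 * n)) : Set (Site 3)) y w) ∧
              (∀ v ∈ box 3 n, ω \ {e} ∉ openConnIn (↑(box 3 (2 * n)) : Set (Site 3)) y v)} ≤ C := by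
  sorry

/-! ## Definitional consistency: the registered theorems ARE the stub `Prop`s (`Iff.rfl`) -/

theorem stub_typeTable_iff : Stubs.stub_typeTable ↔
    ∀ (d n : ℕ) (e : Sym2 (Site d)) (ω : BondConfig (Site d)), e ∈ edgesIn (zdGraph d) (box d (2 * n)) →
      (∑ k ∈ Finset.range (box d n).card,
          ((repEvent d k n).indicator (fun _ => (1 : ℝ)) (insert e ω) -
            (repEvent d k n).indicator (fun _ => (1 : ℝ)) (ω \ {e}))) =
        (birthEvent d n e).indicator (fun _ => (1 : ℝ)) ω -
          (mergeEvent d n e).indicator (fun _ => (1 : ℝ)) ω := Iff.rfl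

theorem stub_ledger_iff : Stubs.stub_ledger ↔ (Stubs.stub_signedRusso → Stubs.stub_typeTable → Ledger) :=
  Iff.rfl

theorem stub_logLedger_iff :
    Stubs.stub_logLedger ↔ (Ledger → Stubs.stub_screening → Stubs.stub_anchor → LogLedger) := Iff.rfl

/-- The `d`-dimensional window statement (stub 7 is `WindowBirthsDim 3`, `Iff.rfl`): used to run the
composition in every dimension and to CHECK the barrier calibration (`windowBirthsDim_false_above_six`). -/
def WindowBirthsDim (d : ℕ) : Prop :=
  ∃ C : ℝ, ∃ᶠ n : ℕ in atTop, ∃ s : ℝ, 0 ≤ s ∧ s ≤ (criticalProbI d : ℝ) ∧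
    crossProb d s n ≤ 1 / 2 ∧ ∫ t in s..(criticalProbI d : ℝ), birthRate d t n ≤ C

theorem stub_windowBirths_iff_dim : Stubs.stub_windowBirths ↔ WindowBirthsDim 3 := Iff.rfl

/-- The six provable stubs deliver the LEDGER and the LOG-LEDGER (pure modus ponens). -/
theorem ledger_of_stubs (hT : Stubs.stub_typeTable) (hR : Stubs.stub_signedRusso)
    (hL : Stubs.stub_ledger) : Ledger :=
  hL hR hT

theorem logLedger_of_stubs (hT : Stubs.stub_typeTable) (hR : Stubs.stub_signedRusso)
    (hScr : Stubs.stub_screening) (hA : Stubs.stub_anchor) (hL : Stubs.stub_ledger)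
    (hS : Stubs.stub_logLedger) : LogLedger :=
  hS (ledger_of_stubs hT hR hL) hScr hA

/-- The LEDGER holds (stubs 1, 2, 5 are theorems of the tree). -/
theorem ledger_holds : Ledger := ledger_of_stubs stub_typeTable stub_signedRusso stub_ledger

/-- The LOG-LEDGER holds (stubs 1–6 are theorems of the tree): for `n ≥ 1`, `b ∈ [0,1]`, `u_n(b) < 1`,
`E_b[N_n] + ∫_0^b merges ≤ -log(1 - u_n(b))`; in particular `P_b(B(n) ↮ ∂ⁱⁿB(2n)) ≤ exp(-E_b[N_n])`. -/
theorem logLedger_holds : LogLedger :=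
  logLedger_of_stubs stub_typeTable stub_signedRusso stub_screening stub_anchor stub_ledger stub_logLedger

/-! ## Proved glue: nonnegativity, the window bound on the mean, the first-moment bound -/

theorem mergeRate_nonneg (d : ℕ) (t : ℝ) (n : ℕ) : 0 ≤ mergeRate d t n :=
  Finset.sum_nonneg fun _ _ => measureReal_nonneg

/-- `-log(1 - u) ≤ 1` for `u ≤ 1/2` (`-log(1-u) = log (1-u)⁻¹ ≤ log 2 ≤ 1`). -/
theorem neg_log_one_sub_le_one {u : ℝ} (hu : u ≤ 1 / 2) : - Real.log (1 - u) ≤ 1 := by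
  have h1 : (0 : ℝ) < 1 - u := by linarith
  have h2 : (1 - u)⁻¹ ≤ 2 := by
    rw [inv_le_comm₀ h1 (by norm_num : (0 : ℝ) < 2)]
    linarith
  rw [← Real.log_inv]
  calc Real.log (1 - u)⁻¹ ≤ Real.log 2 := Real.log_le_log (inv_pos.2 h1) h2
    _ ≤ 2 - 1 := Real.log_le_sub_one_of_pos (by norm_num)
    _ = 1 := by norm_num

/-- **The window bound on the mean** (every `d`, every end point `p ≥ s`): from the ledger on
`[s, p]`, the log-ledger at `s` with `u_n(s) ≤ 1/2`, and a window birth budget `∫_s^p births ≤ C`: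
`E_p[N_n] ≤ C + 1`. -/
theorem meanN_le_of_window {d n : ℕ} {s p C : ℝ} (hs0 : 0 ≤ s) (hsp : s ≤ p)
    (hledger : meanN d p n - meanN d s n =
      (∫ t in s..p, birthRate d t n) - ∫ t in s..p, mergeRate d t n)
    (hlog : crossProb d s n < 1 →
      meanN d s n + (∫ t in (0 : ℝ)..s, mergeRate d t n) ≤ - Real.log (1 - crossProb d s n))
    (hus : crossProb d s n ≤ 1 / 2)
    (hwin : ∫ t in s..p, birthRate d t n ≤ C) :
    meanN d p n ≤ C + 1 := by
  have hm1 : 0 ≤ ∫ t in s..p, mergeRate d t n :=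
    intervalIntegral.integral_nonneg hsp fun t _ => mergeRate_nonneg d t n
  have hm0 : 0 ≤ ∫ t in (0 : ℝ)..s, mergeRate d t n :=
    intervalIntegral.integral_nonneg hs0 fun t _ => mergeRate_nonneg d t n
  have hlt : crossProb d s n < 1 := by linarith
  have hlog' := hlog hlt
  have hlog1 : - Real.log (1 - crossProb d s n) ≤ 1 := neg_log_one_sub_le_one hus
  linarith

/-- **First-moment (Markov) bound for the layered count**: `(M+1) · P(N_n ≥ M+1) ≤ E[N_n]`, i.e.
`(M+1) μ(repEvent d M n) ≤ Σ_{k<#B(n)} μ(repEvent d k n)` when `M + 1 ≤ #B(n)` (the family `repEvent`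
is antitone in `k`, landed `Negative.repEvent_antitone`). -/
theorem markov_repEvent {d M n : ℕ} (μ : Measure (BondConfig (Site d))) [IsFiniteMeasure μ]
    (hM : M + 1 ≤ (box d n).card) :
    ((M + 1 : ℕ) : ℝ) * μ.real (repEvent d M n) ≤
      ∑ k ∈ Finset.range (box d n).card, μ.real (repEvent d k n) := by
  calc ((M + 1 : ℕ) : ℝ) * μ.real (repEvent d M n)
      = ∑ _k ∈ Finset.range (M + 1), μ.real (repEvent d M n) := by
        rw [Finset.sum_const, Finset.card_range, nsmul_eq_mul]
    _ ≤ ∑ k ∈ Finset.range (M + 1), μ.real (repEvent d k n) := by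
        refine Finset.sum_le_sum fun k hk => ?_
        have hkM : k ≤ M := Nat.lt_succ_iff.1 (Finset.mem_range.1 hk)
        exact measureReal_mono (repEvent_antitone d n hkM) (measure_ne_top _ _)
    _ ≤ ∑ k ∈ Finset.range (box d n).card, μ.real (repEvent d k n) :=
        Finset.sum_le_sum_of_subset_of_nonneg (Finset.range_subset_range.2 hM)
          fun _ _ _ => measureReal_nonneg

/-- `#B(n) ≥ n + 1` in `ℤ^d`, `d ≥ 1` (`#B(n) = (2n+1)^d`). -/
theorem succ_le_card_box {d : ℕ} (hd : 1 ≤ d) (n : ℕ) : n + 1 ≤ (box d n).card := by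
  rw [card_box]
  calc n + 1 ≤ 2 * n + 1 := by omega
    _ ≤ (2 * n + 1) ^ d := Nat.le_self_pow (by omega) _

/-! ## The composition (kernel-checked, no `sorry`) — run in every dimension `d ≥ 1` -/

/-- **Composition in dimension `d`**: the ledger on `[s, p_c(d)]` and the log-ledger at `s` (both at
`d`, the latter for `n ≥ 1`) plus `WindowBirthsDim d` give the `d`-dimensional crux with `c = 1/2`:
`E_{p_c}[N_n] ≤ C + 1` (`meanN_le_of_window`), then `(M+1) P_{p_c}(N_n ≥ M+1) ≤ E N_n` with
`M + 1 = 2⌈max C 0⌉₊ + 4 ≥ 2(C + 1)`, i.e. `P_{p_c}((repEvent d M n)ᶜ) ≥ 1/2` frequently. -/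
theorem nonProliferationDim_of_window {d : ℕ} (hd : 1 ≤ d)
    (hL : ∀ (n : ℕ) (a b : ℝ), 0 ≤ a → a ≤ b → b ≤ 1 →
      meanN d b n - meanN d a n = (∫ t in a..b, birthRate d t n) - ∫ t in a..b, mergeRate d t n)
    (hS : ∀ (n : ℕ) (b : ℝ), 1 ≤ n → 0 ≤ b → b ≤ 1 → crossProb d b n < 1 →
      meanN d b n + (∫ t in (0 : ℝ)..b, mergeRate d t n) ≤ - Real.log (1 - crossProb d b n))
    (hW : WindowBirthsDim d) :
    ∃ (M : ℕ) (c : ℝ), 0 < c ∧ ∃ᶠ n : ℕ in atTop,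
      c ≤ (bondPercolation (zdGraph d) (criticalProbI d)).real (repEvent d M n)ᶜ := by
  obtain ⟨C, hC⟩ := hW
  have hpc1 : (criticalProbI d : ℝ) ≤ 1 := (criticalProbI d).2.2
  set C' : ℝ := max C 0 with hC'def
  have hCC' : C ≤ C' := le_max_left _ _
  have hC'0 : 0 ≤ C' := le_max_right _ _
  set M : ℕ := 2 * ⌈C'⌉₊ + 3 with hMdef
  have hM2 : 2 * (C' + 1) ≤ ((M + 1 : ℕ) : ℝ) := by
    have hceil : C' ≤ (⌈C'⌉₊ : ℝ) := Nat.le_ceil C'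
    have hcast : ((M + 1 : ℕ) : ℝ) = 2 * (⌈C'⌉₊ : ℝ) + 4 := by
      rw [hMdef]; push_cast; ring
    rw [hcast]
    linarith
  refine ⟨M, 1 / 2, by norm_num, ?_⟩
  refine (hC.and_eventually (eventually_ge_atTop M)).mono ?_
  rintro n ⟨⟨s, hs0, hspc, hus, hwin⟩, hMn⟩
  have hn1 : 1 ≤ n := le_trans (by omega) hMn
  -- the mean bound at `p_c`
  have hmean : meanN d (criticalProbI d : ℝ) n ≤ C + 1 :=
    meanN_le_of_window hs0 hspc (hL n s (criticalProbI d : ℝ) hs0 hspc hpc1)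
      (hS n s hn1 hs0 (hspc.trans hpc1)) hus hwin
  -- Markov
  have hcard : M + 1 ≤ (box d n).card :=
    le_trans (by omega) (succ_le_card_box hd n)
  have hmk := markov_repEvent (P d (criticalProbI d : ℝ)) (M := M) (n := n) hcard
  have hpos : (0 : ℝ) < ((M + 1 : ℕ) : ℝ) := by exact_mod_cast Nat.succ_pos M
  have hprod : ((M + 1 : ℕ) : ℝ) * (P d (criticalProbI d : ℝ)).real (repEvent d M n) ≤
      ((M + 1 : ℕ) : ℝ) * (1 / 2) := by
    have h1 : ((M + 1 : ℕ) : ℝ) * (P d (criticalProbI d : ℝ)).real (repEvent d M n) ≤ C' + 1 :=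
      hmk.trans (hmean.trans (by linarith))
    linarith
  have hP : (P d (criticalProbI d : ℝ)).real (repEvent d M n) ≤ 1 / 2 :=
    le_of_mul_le_mul_left hprod hpos
  -- back to the measure `P_{p_c}` itself: `projIcc 0 1 ↑p_c = p_c`
  have hproj : Set.projIcc (0 : ℝ) 1 zero_le_one (criticalProbI d : ℝ) = criticalProbI d :=
    Set.projIcc_val zero_le_one (criticalProbI d)
  have hP' : (bondPercolation (zdGraph d) (criticalProbI d)).real (repEvent d M n) ≤ 1 / 2 := by
    have h : (bondPercolation (zdGraph d) (Set.projIcc (0 : ℝ) 1 zero_le_one (criticalProbI d : ℝ))).real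
        (repEvent d M n) ≤ 1 / 2 := hP
    rw [hproj] at h
    exact h
  rw [probReal_compl_eq_one_sub (measurableSet_repEvent d M n)]
  linarith

/-- **Composition `NonProliferation_of`** (gen 3) — hypothesis = the ONE remaining registered stub
`Stubs.stub_windowBirths` BY NAME, conclusion = the crux BY NAME; the six landed stubs are discharged
inside the proof by the tree's theorems (`d = 3` instance of `nonProliferationDim_of_window` through
`Negative.nonProliferation_iff`). -/
theorem NonProliferation_of (hW : Stubs.stub_windowBirths) :
    Summit.CriticalPhenomena.PercolationContinuityZ3.Theses.PercNonProliferation.NonProliferation := by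
  have hLedger : Ledger := ledger_holds
  have hLog : LogLedger := logLedger_holds
  rw [stub_windowBirths_iff_dim] at hW
  rw [nonProliferation_iff]
  exact nonProliferationDim_of_window (by norm_num) (hLedger 3) (hLog 3) hW

/-- **The skeleton IS the crux proof once the last stub is discharged** (D-0027 §3.3): the crux by
name from the registered stub (its only non-standard axiom is the `sorryAx` of `stub_windowBirths`). -/
theorem NonProliferation_proof :
    Summit.CriticalPhenomena.PercolationContinuityZ3.Theses.PercNonProliferation.NonProliferation :=
  NonProliferation_of stub_windowBirths

/-- The gen-2 composition with all seven stub `Prop`s as hypotheses (kept for the record; every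
hypothesis but the last is now a theorem). -/
theorem NonProliferation_of_stubs (hT : Stubs.stub_typeTable) (hR : Stubs.stub_signedRusso)
    (hScr : Stubs.stub_screening) (hA : Stubs.stub_anchor) (hL : Stubs.stub_ledger)
    (hS : Stubs.stub_logLedger) (hW : Stubs.stub_windowBirths) :
    Summit.CriticalPhenomena.PercolationContinuityZ3.Theses.PercNonProliferation.NonProliferation := by
  have hLedger : Ledger := ledger_of_stubs hT hR hL
  have hLog : LogLedger := logLedger_of_stubs hT hR hScr hA hL hS
  rw [stub_windowBirths_iff_dim] at hW
  rw [nonProliferation_iff]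
  exact nonProliferationDim_of_window (by norm_num) (hLedger 3) (hLog 3) hW

/-! ## Barrier calibration, checked: the window statement is FALSE above six dimensions

Given the six dimension-free stubs (which hold in every `d`), `WindowBirthsDim d` for `d ≥ 7` would
give the `d`-dimensional crux, refuted by the landed `Negative.nonProliferation_false_of_twoPointBoundedRatio`
(Aizenman 1997 Thm 4 (3), `SpanningClustersAboveSix_holds`); so stub 7 is exactly where an input false
above six dimensions must enter (`Negative.nonProliferation_false_without_dimThree`). -/

/-- In every `d ≥ 7` satisfying Aizenman's (t-c) with `η = 0`, the window birth budget fails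
(granted stubs 1–6): births in the critical window are NOT bounded — they exceed `E N_n → ∞`. -/
theorem windowBirthsDim_false_above_six (hT : Stubs.stub_typeTable) (hR : Stubs.stub_signedRusso)
    (hScr : Stubs.stub_screening) (hA : Stubs.stub_anchor) (hL : Stubs.stub_ledger)
    (hS : Stubs.stub_logLedger) {d : ℕ} (hd : 6 < d) (hτ : TwoPointBoundedRatio d) :
    ¬ WindowBirthsDim d := by
  have hLedger : Ledger := ledger_of_stubs hT hR hL
  have hLog : LogLedger := logLedger_of_stubs hT hR hScr hA hL hS
  haveI : NeZero d := ⟨by omega⟩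
  intro hW
  exact nonProliferation_false_of_twoPointBoundedRatio hd hτ
    (nonProliferationDim_of_window (by omega) (hLedger d) (hLog d) hW)

/-- Unconditionally for `d ≥ 11`, granted Hara's `η = 0` (`Hara2008_etaZeroXSpace`). -/
theorem windowBirthsDim_false_of_hara (hT : Stubs.stub_typeTable) (hR : Stubs.stub_signedRusso)
    (hScr : Stubs.stub_screening) (hA : Stubs.stub_anchor) (hL : Stubs.stub_ledger)
    (hS : Stubs.stub_logLedger) (hH : Hara2008_etaZeroXSpace) {d : ℕ} (hd : 11 ≤ d) :
    ¬ WindowBirthsDim d := by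
  have hLedger : Ledger := ledger_of_stubs hT hR hL
  have hLog : LogLedger := logLedger_of_stubs hT hR hScr hA hL hS
  intro hW
  exact nonProliferation_false_of_hara hH hd (nonProliferationDim_of_window (by omega) (hLedger d) (hLog d) hW)

/-- **The reduction, unconditional in its provable part**: the crux follows from the window birth budget
alone (`WindowBirthsDim 3 = Stubs.stub_windowBirths`). -/
theorem nonProliferation_of_windowBirths (hW : Stubs.stub_windowBirths) :
    Summit.CriticalPhenomena.PercolationContinuityZ3.Theses.PercNonProliferation.NonProliferation :=
  NonProliferation_of hW

/-- **Calibration, unconditional**: for `d ≥ 7` with `TwoPointBoundedRatio d` the window birth budget fails. -/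
theorem windowBirthsDim_false_above_six' {d : ℕ} (hd : 6 < d) (hτ : TwoPointBoundedRatio d) :
    ¬ WindowBirthsDim d :=
  windowBirthsDim_false_above_six stub_typeTable stub_signedRusso stub_screening stub_anchor stub_ledger
    stub_logLedger hd hτ

end Summit.CriticalPhenomena.PercolationContinuityZ3.Cruxes.NonProliferation.BirthMergeLedger

end
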